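import Literature.MathematicalPhysics.QuantumLattice.StrongCouplingBosonisation
import Literature.MathematicalPhysics.StatisticalMechanics.UNChiralSymmetryBreaking
import HarnessLib

/-!
# The chiral condensate of β = 0 U(N) lattice gauge theory with one staggered fermion, every N,
# at the gauge level (Salmhofer–Seiler's Remark 4.10 (3) / (4.44), conditional on the
# Hall–Puder–Sawin ∕ Amini zero-free fact)

Salmhofer–Seiler (CMP 139 (1991)) prove the condensate form of chiral symmetry breaking,
`liminf_{m→0⁺} ⟨ψ̄ψ⟩ > 0`, at `β = 0` for `N = 1` / the NJL systems (Thm. 4.3, Cor. 4.4 (1)), and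
state the `U(N)` analogue (4.44) only under the clustering hypothesis of Remark 4.10 (3).  The
Literature files `UNPartitionFunctionZeros` (the ONE vendored fact `HallPuderSawinAmini_uNZeroFree`:
the `β = 0` `U(N)` partition functions are zero-free for `Re m > 0`, in print as the stability of
the `N`-matching polynomial), `UNChiralCondensateLowerBound` and `UNChiralSymmetryBreaking` derive
(4.44) for the `U(N)` complex spin system, every `N`, conditionally on that displayed hypothesis.
This file transports the statements to the honest Berezin–Haar expectations of the gauge theory
through the tree's bosonisation identity (2.24) `⟨ψ̄ψ(x)⟩_Λ = 2N⟨σ_x⟩_Λ` (`fermiExpect_meson`),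
exactly as `StrongCouplingChiralLROAllColours` does for the two-point function:

* `gauge_condensate_lower_bound_allN (h)` — `ν ≥ 3`, `N ≥ 1`, `m > 0`, `ε > 0`: on all large even
  tori (any linear order of the sites, any link signs `Γ² = 1`),
  `Re⟨ψ̄ψ(0)⟩_Λ(m) ≥ (√(m² + 2νN(1 - 2S(ν))) - m)/ν - ε` — (4.44) with `K(N) ↦ N`;
* **`gauge_chiralSymmetryBreaking_condensate_allN (h)`** — `ν ≥ 4`, `N ≥ 1`, `0 < m ≤ 1`, `ε > 0`:
  on all large even tori `Re⟨ψ̄ψ(0)⟩_Λ(m) ≥ 3N/(5(√(1 + 2νN) + 1)) - ε`, a positive constant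
  independent of `m` and `Λ` — the chiral condensate of the `β = 0` `U(N)` theory does not vanish
  as `m → 0⁺` (after the volume), for EVERY number of colours, given `h`;
* `gauge_chiralSymmetryBreaking_condensate_staggered_allN (h)` — the same for the staggered
  phases `Γ_μ(x)` of (2.4).

Scope (honest): `β = 0` only; gauge group `U(N)` (not `SU(N)`: its partition function is not
zero-free); one staggered flavour; finite even tori with volume-uniform constants; CONDITIONAL on
the displayed fact `h`, whose proof is not in Mathlib; nothing about `β > 0`, the continuum, a mass
gap or the summit's `QCD` conjunct.

## References
* [SalmhoferSeiler1991] M. Salmhofer, E. Seiler, Commun. Math. Phys. 139 (1991) 395–432: (2.21),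
  (2.24), Remark 4.10 (3) (4.44), Cor. 4.4 (1), Prop. 4.2 (4).
* [Amini2019] N. Amini, arXiv:1905.02264, Thm. 3.7.
* [HallPuderSawin2018] C. Hall, D. Puder, W. F. Sawin, Adv. Math. 323 (2018) 367–410, §2.2, §5.2.
-/

noncomputable section

namespace Literature.MathematicalPhysics.QuantumLattice

namespace StrongCoupling

open MvPolynomial Filter Topology
open Literature.Probability.LatticeModels (TorusSite Site)
open Literature.Probability.LatticeModels
open Literature.MathematicalPhysics.StatisticalMechanics

variable {ν : ℕ} {N : ℕ}

/-- Even and nonzero ⇒ `> 1`. [folklore] -/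
private theorem one_lt_of_even'' {L : ℕ} [NeZero L] (hL : Even L) : 1 < L := by
  have := NeZero.ne L
  obtain ⟨k, hk⟩ := hL
  omega

/-- `Re⟨ψ̄ψ(0)⟩_Λ(m) = 2N⟨σ_0⟩_Λ(m)` ((2.24), real part). [cite: SalmhoferSeiler1991, §2 (2.24)] -/
theorem re_fermiExpect_meson_zero {L : ℕ} [NeZero L] [LinearOrder (TorusSite ν L)] (hL : 1 < L)
    (Γ : TorusSite ν L × Fin ν → ℂ) (hΓ : ∀ b, Γ b ^ 2 = 1) (m : ℝ) :
    (fermiExpect (torusLinks ν L) Γ (m : ℂ)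
        (fun _ => (meson 0 : FermiAlg (TorusSite ν L) N))).re =
      2 * N * ComplexSpin.expect N m (ComplexSpin.uNBondCoeff N) (X (0 : TorusSite ν L)) := by
  rw [fermiExpect_meson hL Γ hΓ m 0]
  have : (2 : ℂ) * N * (ComplexSpin.expect N m (ComplexSpin.uNBondCoeff N)
      (X (0 : TorusSite ν L)) : ℂ) =
      ((2 * N * ComplexSpin.expect N m (ComplexSpin.uNBondCoeff N) (X (0 : TorusSite ν L)) : ℝ) : ℂ) := by
    push_cast; ring
  rw [this, Complex.ofReal_re]

/-- **(4.44) at the gauge level, `U(N)`, EVERY `N ≥ 1`** (given the vendored fact): for `ν ≥ 3`,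
`m > 0`, `ε > 0`, on all large even tori (any linear order, any link signs `Γ² = 1`) the chiral
condensate of the `β = 0` `U(N)` theory obeys `Re⟨ψ̄ψ(0)⟩_Λ(m) ≥ (√(m² + 2νN(1 - 2S(ν))) - m)/ν - ε`.
[cite: SalmhoferSeiler1991, Remark 4.10 (3) (4.44) with (2.24)][cite: Amini2019, Thm. 3.7][cite: HallPuderSawin2018, §2.2 and §5.2] -/
theorem gauge_condensate_lower_bound_allN (h : HallPuderSawinAmini_uNZeroFree) (hν : 3 ≤ ν)
    (hN : 1 ≤ N) {m : ℝ} (hm : 0 < m) {ε : ℝ} (hε : 0 < ε) :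
    ∃ L₀ : ℕ, ∀ (L : ℕ) [NeZero L] [LinearOrder (TorusSite ν L)]
      (Γ : TorusSite ν L × Fin ν → ℂ), (∀ b, Γ b ^ 2 = 1) → Even L → L₀ ≤ L →
        (Real.sqrt (m ^ 2 + 2 * ν * N * (1 - 2 * ComplexSpin.fluctS ν)) - m) / ν - ε ≤
          (fermiExpect (torusLinks ν L) Γ (m : ℂ)
            (fun _ => (meson 0 : FermiAlg (TorusSite ν L) N))).re := by
  have hNpos : (0 : ℝ) < N := by exact_mod_cast hN
  have hνpos : (0 : ℝ) < ν := by exact_mod_cast (show 0 < ν by omega)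
  obtain ⟨L₀, hL₀⟩ := ComplexSpin.uN_condensate_lower_bound (ν := ν) h hν hN hm
    (ε := ε / (2 * N)) (by positivity)
  refine ⟨L₀, fun L _ _ Γ hΓ hE hLe => ?_⟩
  rw [re_fermiExpect_meson_zero (one_lt_of_even'' hE) Γ hΓ m]
  have key := hL₀ L hE hLe
  have e : 2 * (N : ℝ) * ((Real.sqrt (m ^ 2 + 2 * ν * N * (1 - 2 * ComplexSpin.fluctS ν)) - m) /
      (2 * ν * N) - ε / (2 * N)) =
      (Real.sqrt (m ^ 2 + 2 * ν * N * (1 - 2 * ComplexSpin.fluctS ν)) - m) / ν - ε := by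
    field_simp
  rw [← e]
  exact mul_le_mul_of_nonneg_left key (by positivity)

/-- **Chiral symmetry breaking in the condensate form for `β = 0` `U(N)` lattice gauge theory with
one staggered fermion, EVERY `N ≥ 1`, `ν ≥ 4`, at the gauge level** (Remark 4.10 (3) with the
numerical input of Prop. 4.2 (4); conditional on the vendored zero-free fact): for every mass
`0 < m ≤ 1` and `ε > 0`, on all large even tori (any linear order, any link signs `Γ² = 1`),
`Re⟨ψ̄ψ(0)⟩_Λ(m) ≥ 3N/(5(√(1 + 2νN) + 1)) - ε` — a positive constant independent of `m` and `Λ`.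
[cite: SalmhoferSeiler1991, Remark 4.10 (3) (4.44), Cor. 4.4 (1) and (2.24)][cite: Amini2019, Thm. 3.7][cite: HallPuderSawin2018, §2.2 and §5.2] -/
theorem gauge_chiralSymmetryBreaking_condensate_allN (h : HallPuderSawinAmini_uNZeroFree)
    (hν : 4 ≤ ν) (hN : 1 ≤ N) {m : ℝ} (hm : 0 < m) (hm1 : m ≤ 1) {ε : ℝ} (hε : 0 < ε) :
    ∃ L₀ : ℕ, ∀ (L : ℕ) [NeZero L] [LinearOrder (TorusSite ν L)]
      (Γ : TorusSite ν L × Fin ν → ℂ), (∀ b, Γ b ^ 2 = 1) → Even L → L₀ ≤ L →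
        3 * N / (5 * (Real.sqrt (1 + 2 * ν * N) + 1)) - ε ≤
          (fermiExpect (torusLinks ν L) Γ (m : ℂ)
            (fun _ => (meson 0 : FermiAlg (TorusSite ν L) N))).re := by
  have hNpos : (0 : ℝ) < N := by exact_mod_cast hN
  obtain ⟨L₀, hL₀⟩ := ComplexSpin.uN_chiralSymmetryBreaking_condensate (ν := ν) h hν hN hm hm1
    (ε := ε / (2 * N)) (by positivity)
  refine ⟨L₀, fun L _ _ Γ hΓ hE hLe => ?_⟩
  rw [re_fermiExpect_meson_zero (one_lt_of_even'' hE) Γ hΓ m]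
  have key := hL₀ L hE hLe
  have hden : 0 < Real.sqrt (1 + 2 * (ν : ℝ) * N) + 1 := by positivity
  have e : 2 * (N : ℝ) * (3 / (10 * (Real.sqrt (1 + 2 * ν * N) + 1)) - ε / (2 * N)) =
      3 * N / (5 * (Real.sqrt (1 + 2 * ν * N) + 1)) - ε := by
    field_simp
    ring
  rw [← e]
  exact mul_le_mul_of_nonneg_left key (by positivity)

/-- **The same for the staggered action itself** (phases `Γ_μ(x)` of (2.4)), every `N ≥ 1`, `ν ≥ 4`.
[cite: SalmhoferSeiler1991, Remark 4.10 (3) (4.44) with (2.4) and (2.24)] -/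
theorem gauge_chiralSymmetryBreaking_condensate_staggered_allN (h : HallPuderSawinAmini_uNZeroFree)
    (hν : 4 ≤ ν) (hN : 1 ≤ N) {m : ℝ} (hm : 0 < m) (hm1 : m ≤ 1) {ε : ℝ} (hε : 0 < ε) :
    ∃ L₀ : ℕ, ∀ (L : ℕ) [NeZero L] [LinearOrder (TorusSite ν L)], Even L → L₀ ≤ L →
      3 * N / (5 * (Real.sqrt (1 + 2 * ν * N) + 1)) - ε ≤
        (fermiExpect (torusLinks ν L) (fun p => ((staggeredPhase p.1 p.2 : ℤ) : ℂ)) (m : ℂ)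
          (fun _ => (meson 0 : FermiAlg (TorusSite ν L) N))).re := by
  obtain ⟨L₀, hL₀⟩ := gauge_chiralSymmetryBreaking_condensate_allN (ν := ν) h hν hN hm hm1 hε
  exact ⟨L₀, fun L _ _ hE hL => hL₀ L _ (fun p => staggeredPhase_sq p.1 p.2) hE hL⟩

/-- The constant is positive. [cite: SalmhoferSeiler1991, Cor. 4.4 (1)] -/
theorem gauge_chiralCondensate_const_pos (hN : 1 ≤ N) (ν : ℕ) :
    0 < 3 * (N : ℝ) / (5 * (Real.sqrt (1 + 2 * ν * N) + 1)) := by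
  have hNpos : (0 : ℝ) < N := by exact_mod_cast hN
  positivity

end StrongCoupling

end Literature.MathematicalPhysics.QuantumLattice

end
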